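import Summits.ValiantsHypothesis.ValiantsHypothesis.Theorems.FifoMatchingXcDivisionChamberCertificate
import Summits.ValiantsHypothesis.ValiantsHypothesis.Theorems.FifoMatchingNNDivisionHardLocalization
import Summits.ValiantsHypothesis.ValiantsHypothesis.Theorems.FifoMatchingNNDivisionHardExactPencilDeadBlocks

/-!
# FifoMatching · NNDivisionHard — `ListFloor41`: THE EXPONENTIAL LIST-LENGTH FLOOR, by name in the 21181 currency
(val-idea-41 g6; a POINTER, not a new engine)

Crux workfile for `stmt-ValiantsHypothesis-21181` (`FifoMatching.NNDivisionHard`), REFUTE lens «a `Q` with small `xc(COR + Q)`».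

PROP A of the LENS-dual cell is a THEOREMS theorem by name —
`XcDivision.corPolytopeGraph_top_add_hull_three_pow_le` (✓ p661097 `Theorems/FifoMatchingXcDivisionChamberCertificate.lean`):
for every list of `N ≥ 1` points `q` and every size-`r` EF of `COR(K_h) + conv q`, `3^h ≤ N·(r+1)·2^h` (hitting family /
Minkowski cancellation `COR = (COR + Q) ⊖ Q = ⋂ⱼ (COR + Q − qⱼ)`, an intersection of `N` translates of the cheap host).
The enemy spec of record on 21181 carries as its vertex-count floor (E-7) `FatTwins.enemy_many_members`
(`C(h,s) ≤ N²·C(ℓ,s)`, i.e. `N ≥ h^{(log₂log₂h)/4 − o(1)}`); PROP A gives an EXPONENTIAL floor and this file only restates it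
in the `Localization` currency so the census can cite it by name:

* `enemy_list_floor`      — `3^h ≤ (K+1)·(r+1)·2^h` for every `q : Fam h K` whose sum with `COR(K_h)` has a size-`r` EF;
  `enemy_list_floor_T` — at budget `r ≤ T c h`: `3^h ≤ (K+1)·(T c h + 1)·2^h`, i.e. an enemy list has
  `N = K+1 ≥ 1.5^h / (T c h + 1)` members (vertices of `conv q` included) — exponential in `h`, for every `c`.
* `ShortList : PClass := fun h K _ => (K+1)·2^{⌊h/2⌋} ≤ 3^{⌊h/2⌋}` (lists of length `≤ 1.5^{⌊h/2⌋} ≈ 2^{0.29 h}`, any shape,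
  any budget) and ★ `shortList_decided : Decided ShortList` (`three_pow_half_le` + `ExactPencil.T_lt_of_block_div 2`).
  Census reading: species «SHORT LISTS» ⊇ COLUMN-HIT's «every list with `2K² ≤ n` points» (`cor_add_fewVertex_decided`)
  and ⊇ the (E-7) floor; membership test = count the list.

Honest label: POINTER / bookkeeping (two corollaries of an existing Theorems theorem); no new mathematics; 21181 OPEN;
VP ≠ VNP NOT proved.  Standard axioms only.
-/

set_option linter.dupNamespace false

namespace Summit.ValiantsHypothesis.ValiantsHypothesis.Cruxes.NNDivisionHard.ListFloor41

open scoped Pointwise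
open Literature.Barriers.PneNP (HasEFOfSize)
open Literature.Combinatorics.Optimization (corPolytopeGraph)
open Summit.ValiantsHypothesis.ValiantsHypothesis.Theorems.FifoMatching.Localization (Fam PClass Decided T)
open Summit.ValiantsHypothesis.ValiantsHypothesis.Theorems.FifoMatching.XcDivision
  (corPolytopeGraph_top_add_hull_three_pow_le)
open Summit.ValiantsHypothesis.ValiantsHypothesis.Theorems.FifoMatching.ExactPencil (T_lt_of_block_div)

/-- **THE LIST-LENGTH FLOOR** (PROP A restated over `Fam h K`): `3^h ≤ (K+1)·(r+1)·2^h`. -/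
theorem enemy_list_floor {h K r : ℕ} (q : Fam h K)
    (hEF : HasEFOfSize (corPolytopeGraph (⊤ : SimpleGraph (Fin h)) + convexHull ℝ (Set.range q)) r) :
    3 ^ h ≤ (K + 1) * (r + 1) * 2 ^ h :=
  corPolytopeGraph_top_add_hull_three_pow_le q (Nat.succ_pos K) hEF

/-- at budget `r ≤ T c h`: `3^h ≤ (K+1)·(T c h + 1)·2^h` — an enemy list has at least `1.5^h / (T c h + 1)` members. -/
theorem enemy_list_floor_T {c h K r : ℕ} (q : Fam h K)
    (hEF : HasEFOfSize (corPolytopeGraph (⊤ : SimpleGraph (Fin h)) + convexHull ℝ (Set.range q)) r)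
    (hr : r ≤ T c h) : 3 ^ h ≤ (K + 1) * (T c h + 1) * 2 ^ h :=
  (enemy_list_floor q hEF).trans
    (Nat.mul_le_mul_right _ (Nat.mul_le_mul_left _ (Nat.succ_le_succ hr)))

/-- the same floor in real form: `(3/2)^h ≤ (K+1)·(T c h + 1)`. -/
theorem enemy_list_floor_real {c h K r : ℕ} (q : Fam h K)
    (hEF : HasEFOfSize (corPolytopeGraph (⊤ : SimpleGraph (Fin h)) + convexHull ℝ (Set.range q)) r)
    (hr : r ≤ T c h) : (3 / 2 : ℝ) ^ h ≤ ((K + 1 : ℕ) : ℝ) * ((T c h + 1 : ℕ) : ℝ) := by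
  have h3 := enemy_list_floor_T (c := c) q hEF hr
  have h2 : (0 : ℝ) < 2 ^ h := by positivity
  rw [div_pow, div_le_iff₀ h2]
  exact_mod_cast h3

/-- **SHORT LISTS**: at most `1.5^{⌊h/2⌋}` members (stated multiplicatively in `ℕ`). -/
def ShortList : PClass := fun h K _ => (K + 1) * 2 ^ (h / 2) ≤ 3 ^ (h / 2)

/-- arithmetic heart: `3^h ≤ N·(r+1)·2^h` together with `N·2^{⌊h/2⌋} ≤ 3^{⌊h/2⌋}` forces `3^{⌊h/2⌋} ≤ (r+1)·2^{⌊h/2⌋}`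
(else the product of the two strict/weak halves is `< 3^{2⌊h/2⌋} ≤ 3^h`, and the odd case loses only a factor `2 < 3`). -/
theorem three_pow_half_le {h N r : ℕ} (h3 : 3 ^ h ≤ N * (r + 1) * 2 ^ h)
    (hN : N * 2 ^ (h / 2) ≤ 3 ^ (h / 2)) : 3 ^ (h / 2) ≤ (r + 1) * 2 ^ (h / 2) := by
  by_contra hlt
  rw [not_le] at hlt
  set a := h / 2 with ha
  have h3a : 0 < 3 ^ a := pow_pos (by norm_num) a
  -- the product of the two halves
  have key : N * (r + 1) * 2 ^ (2 * a) < 3 ^ (2 * a) := by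
    have e1 : N * (r + 1) * 2 ^ (2 * a) = (N * 2 ^ a) * ((r + 1) * 2 ^ a) := by ring
    have e2 : 3 ^ (2 * a) = 3 ^ a * 3 ^ a := by ring
    rw [e1, e2]
    calc N * 2 ^ a * ((r + 1) * 2 ^ a) ≤ 3 ^ a * ((r + 1) * 2 ^ a) := Nat.mul_le_mul_right _ hN
      _ < 3 ^ a * 3 ^ a := Nat.mul_lt_mul_of_pos_left hlt h3a
  have hdm : h = 2 * a + h % 2 := by omega
  rcases Nat.mod_two_eq_zero_or_one h with h0 | h1
  · rw [h0, add_zero] at hdm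
    rw [hdm] at h3
    exact absurd (h3.trans_lt key) (lt_irrefl _)
  · rw [h1] at hdm
    rw [hdm] at h3
    have : 3 ^ (2 * a + 1) ≤ 2 * (N * (r + 1) * 2 ^ (2 * a)) := by
      calc 3 ^ (2 * a + 1) ≤ N * (r + 1) * 2 ^ (2 * a + 1) := h3
        _ = 2 * (N * (r + 1) * 2 ^ (2 * a)) := by ring
    have h33 : 3 ^ (2 * a + 1) = 3 * 3 ^ (2 * a) := by ring
    omega

/-- ★ **SHORT LISTS ARE DECIDED** (any shape, any budget): `Decided ShortList`. -/
theorem shortList_decided : Decided ShortList := by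
  intro c
  obtain ⟨n₀, hn₀⟩ := T_lt_of_block_div 2 (by norm_num) c
  exact ⟨n₀, fun h hh K q r hX hEF => hn₀ h hh r (three_pow_half_le (enemy_list_floor q hEF) hX)⟩

end Summit.ValiantsHypothesis.ValiantsHypothesis.Cruxes.NNDivisionHard.ListFloor41
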